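import Literature.AlgebraicGeometry.Resolution.Temkin2008Localization
import HarnessLib

/-!
# (LU) in residue characteristic zero directly from Hironaka's theorem over local rings

Topic: `Literature/AlgebraicGeometry/Resolution`. Companion of `Temkin2008.lean` /
`Temkin2008Localization.lean` (proofs only, no new notions). The only dependent of the named
fact `Temkin2008` is the re-rooting `luCompleteChar0_of_temkin2008 : Temkin2008 → Stacks07QU →
Stacks07QW_complete → CossartPiltant2019LUCompleteChar0` (Cossart–Piltant's (LU) for complete
Noetherian local domains of dimension three and residue characteristic zero). That dependent
concerns LOCAL rings only, and for a local quasi-excellent ring `A` of residue characteristic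
zero the scheme `Spec A` is itself of finite type over the local base `Spec A` — so the leaf
`Hironaka1964_local` of the decomposition of `Temkin2008` (Hironaka 1964, Main Theorem I over
local quasi-excellent rings, in Temkin's reading, `Temkin2008Localization.lean`) already
resolves `Spec A`, without Temkin's globalization (Prop. 2.3.4) and without the excellence
facts `Stacks07QU` / `Stacks07QU_localization`:

* `Hironaka1964_local.hasResolution_spec` — `Spec A` has a resolution for every quasi-excellent
  local domain `A` with residue field of characteristic zero;
* `Hironaka1964_local.cpLocalUniformization` — hence `CPLocalUniformization A` (valuative
  criterion, `exists_fg_regular_of_hasResolution`, `ResolutionLU.lean`);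
* `luCompleteChar0_of_hironaka1964_local : Hironaka1964_local → Stacks07QW_complete →
  CossartPiltant2019LUCompleteChar0` and the assembly `cossartPiltant2019_of_local''` — the
  characteristic-zero leaf of `ArithmeticalThreefoldsLocal.lean` re-rooted in Hironaka's theorem
  alone (trust base strictly contained in that of `cossartPiltant2019_of_local'`, since
  `Hironaka1964_local` is a leaf under `Temkin2008`, `temkin2008_of_localization`).

## Sources

* H. Hironaka, Ann. of Math. 79 (1964), Main Theorem I; read as in M. Temkin, Adv. Math. 219
  (2008) = arXiv:math/0703678, p. 3 ("any integral scheme of finite type over a local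
  quasi-excellent ring of residue characteristic zero admits a successive embedded resolution of
  singularities") and p. 13 (Thm. 2.3.6). [Hironaka1964] [Temkin2008]
* V. Cossart, O. Piltant, J. Algebra 529 (2019), proof of Prop. 4.10 (arXiv v1: 4.8), first
  paragraph ("the equicharacteristic zero version of theorem 1.1 being known").
  [CossartPiltant2019]
-/

noncomputable section

open CategoryTheory AlgebraicGeometry TopologicalSpace IsLocalRing

namespace Literature.AlgebraicGeometry.Resolution

universe u

/-- **`Spec A` has a resolution for every quasi-excellent local domain `A` of residue
characteristic zero**, from Hironaka's theorem over the local base `A` applied to the integral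
finite type `A`-scheme `Spec A` itself (a desingularization is a resolution,
`Scheme.AdmitsDesingularization.hasResolution`).
[cite: Temkin2008, §1 p. 3 and Thm. 2.3.6 (Hironaka 1964, Main Theorem I)] -/
theorem Hironaka1964_local.hasResolution_spec (hH : Hironaka1964_local.{u}) (A : Type u)
    [CommRing A] [IsDomain A] [IsLocalRing A] (hA : IsQuasiExcellentRing A)
    (h0 : CharZero (ResidueField A)) : Scheme.HasResolution (Spec (.of A)) := by
  haveI : IsNoetherianRing A := hA.isNoetherianRing
  haveI : IsNoetherianRing (CommRingCat.of A) := ‹IsNoetherianRing A›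
  haveI : IsDomain (CommRingCat.of A) := ‹IsDomain A›
  haveI : IsNoetherian (Spec (.of A)) := {}
  exact (hH A hA h0 (Spec (.of A)) (𝟙 _)).hasResolution

/-- **(LU) in residue characteristic zero from Hironaka's theorem over local rings**: for every
quasi-excellent local domain `A` whose residue field has characteristic `0` (any dimension),
`CPLocalUniformization A` — resolve `Spec A` (`Hironaka1964_local.hasResolution_spec`) and apply
the valuative criterion (`exists_fg_regular_of_hasResolution`).
[cite: CossartPiltant2019, proof of Prop. 4.10 (arXiv v1: 4.8)] -/
theorem Hironaka1964_local.cpLocalUniformization (hH : Hironaka1964_local.{u}) (A : Type u)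
    [CommRing A] [IsDomain A] [IsLocalRing A] (hA : IsQuasiExcellentRing A)
    (h0 : CharZero (ResidueField A)) : CPLocalUniformization A := by
  intro K _ _ _ O hAO _ _
  obtain ⟨T, hT, ⟨s, rfl⟩, hreg⟩ :=
    exists_fg_regular_of_hasResolution O hAO (hH.hasResolution_spec A hA h0)
  exact ⟨s, hT, hreg⟩

/-- **`CossartPiltant2019LUCompleteChar0` from Hironaka's theorem over local rings**: complete
Noetherian local rings are excellent (`Stacks07QW_complete`), so `Hironaka1964_local` gives (LU)
for complete local domains of dimension three and residue characteristic zero.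
[cite: CossartPiltant2019, proof of Prop. 4.10 (arXiv v1: 4.8)] -/
theorem luCompleteChar0_of_hironaka1964_local (hH : Hironaka1964_local.{u})
    (h07c : Stacks07QW_complete.{u}) : CossartPiltant2019LUCompleteChar0.{u} := by
  intro A _ _ _ _ _ _ h0
  exact hH.cpLocalUniformization A (h07c A).isQuasiExcellentRing h0

/-- **Assembly with the characteristic-zero leaf re-rooted in Hironaka's theorem alone**: as
`cossartPiltant2019_of_local'` (`Temkin2008.lean`) with `Temkin2008`, `Stacks07QU` replaced by
the single leaf `Hironaka1964_local`. [cite: CossartPiltant2019, Ch. 4] -/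
theorem cossartPiltant2019_of_local'' (hloc : CossartPiltant2019Local.{u})
    (hred : CossartPiltant2019ReductionP.{u}) (hH : Hironaka1964_local.{u})
    (h07c : Stacks07QW_complete.{u}) (h48 : CossartPiltant2019LU3OfComplete.{u})
    (hCJS : CossartJannsenSaito2020.{u}) (hP : CossartPiltant2019Patching.{u}) :
    CossartPiltant2019.{u} :=
  cossartPiltant2019_of_local hloc hred (luCompleteChar0_of_hironaka1964_local hH h07c) h48 hCJS hP

end Literature.AlgebraicGeometry.Resolution

end
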